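import Summits.BirchSwinnertonDyer.BirchSwinnertonDyer.Theorems.EisensteinPrimesResidualDevissageFiniteKernel
import Summits.BirchSwinnertonDyer.BirchSwinnertonDyer.Theorems.EisensteinPrimesKellerYinLemma511NonsplitOfPrint
import Summits.BirchSwinnertonDyer.BirchSwinnertonDyer.Theorems.EisensteinPrimesKellerYinLemma511IffResidualFinite
import Literature.NumberTheory.EllipticCurves.KellerYin2024.CharacterSelmerGroups
import HarnessLib

/-!
# Keller–Yin Lemma 5.1.1 (BOTH signs) from ONE character-level statement: the finiteness of the residual
# UNRAMIFIED Selmer group of a character over the anticyclotomic tower (Keller–Yin arXiv:2402.12781v2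
# Prop. 1.2.5, finiteness clause, ARBITRARY `θ` — preprint) ⟹ `Sel_v̄^{Sf}(K_∞, E_K[p^∞])[p]` finite ⟹
# `X^{Sf}` `Λ`-torsion with `μ = 0` (cell `bsd-eis`, seat `bsd-line-x2-p2` gen 4, D-0154 KEY row 5; crux 4
# `BSDpOnCellC` line b1 v12, stub `stub_lemma511`; companions p626493, p628626, p624583, p621903)

HONEST FRAMING (cell `bsd-eis`, run/shared/lean/pub/bsd-eis/): tool theorems (no definition, no new named
fact here, no `sorry`); every theorem here is CONDITIONAL on its hypothesis `hfact` = Keller–Yin Prop. 1.2.5's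
finiteness clause for characters spelled out (an unrefereed claim, `[claim: KellerYin2024, status: under-review]`;
as a named fact: `KellerYin2024.prop125_residualCharacterUnrSelmer_finite_OPEN`, proposed separately); nothing about any curve is asserted; nothing
booked; no label or count moves; BSD and the main conjectures are proved for NO curve. Helper
`--supports stmt-BirchSwinnertonDyer-19034`; closes no registered stub (it DERIVES v12's `stub_lemma511`, itself a
preprint claim, from a smaller preprint claim with no elliptic curve in it).

## Why

After p626493 the NON-SPLIT half of `stub_lemma511` (Keller–Yin Lemma 5.1.1 at `p ‖ N`) rests on the PUBLISHED
CGLS22 Prop. 14, whose hypothesis `θ|_{G_v̄} ∉ {1, ω}` holds for both characters of `E[p]^{ss}` at a non-split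
prime and FAILS for both at a split prime (`{1, ω}`, `X2.TateLineDecomposition.fix_or_quot_of_split`). Keller–Yin
§1.2 removes that hypothesis: Thm. 1.2.2 (Rubin 1991/1994 + Hida 2010 + de Shalit, in the `𝓕_nr` formulation —
unramified instead of strict at `v̄`) holds for every `θ` whose conductor is supported on split primes, and
Prop. 1.2.5 concludes «Moreover, `H¹_{𝓕_nr}^S(K, M_θ[𝔭])` is finite» for every such `θ` ("which recovers [CGLS] for
arbitrary characters (their assumption `θ|_{G_v̄} ≠ 1` is not essential)", proof of Lemma 1.2.4). That single
character-level sentence is the named preprint fact `KellerYin2024.prop125_residualCharacterUnrSelmer_finite_OPEN`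
(this seat, file `KellerYin2024/CharacterResidualUnrSelmerFinite`; the tree's `KellerYin2024.unrSelmer` IS
`H¹_{𝓕_nr^S}` in the `K_∞`-formulation, file `KellerYin2024/CharacterSelmerGroups`).
With the dévissage WITHOUT the non-anomalous clause (p628626,
`ResidualDevissageFiniteKernel.finite_selmerAc_pTorsion_of_line_devissage_of_finite`) no local hypothesis on the
rational line is needed any more, so BOTH signs follow:

* §1 `strictResidual_finite_of_unrResidual_finite` — strict ⊆ unramified at `v̄`
  (`KellerYin2024.grSelmer_le_unrSelmer`; Castella's and the Summits-side `bdpData` agree definitionally).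
* §2 **`residualFinite_of_unrCharacterFinite`** — the fact ⟹ `{s ∈ Sel_v̄^{Sf}(K_∞, E_K[p^∞]) : p s = 0}` finite at EVERY
  datum of Lemma 5.1.1 (`2 < p`, `Mult` — split OR non-split —, `Red`, `K` imaginary quadratic Heegner for `N_E`,
  `(p)` split, `v̄ ∋ p`, `κ` anticyclotomic, `Sf` = places over `N_E` off `p`): rational line, base change,
  `Sf` bookkeeping and unramifiedness exactly as in p626493, the fact for `Φ_K` and `E_K[p]/Φ_K`, §1, p628626 §3.
* §3 **`lemma511_OPEN_of_unrCharacterFinite`** : ⟨that clause, spelled out⟩ →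
  `KellerYin2024.lemma511_imprimitive_isTorsion_muInvariant_eq_zero_mult_OPEN` (through p624583's
  `lemma511_OPEN_of_residualFinite`). The clause is carried as an EXPLICIT hypothesis `hfact` whose text is, binder
  for binder, the named preprint fact `KellerYin2024.prop125_residualCharacterUnrSelmer_finite_OPEN` (proposed by this
  seat as `Literature/…/KellerYin2024/CharacterResidualUnrSelmerFinite.lean`, review-queued at the time of writing);
  the one-line by-name corollary `lemma511_OPEN_of_prop125_OPEN` follows once that file is in the tree.

What this is NOT: not a proof of Rubin's main conjecture, Hida's `μ = 0` or Keller–Yin Thm. 1.2.2; the typed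
clause stays an unrefereed claim until Keller–Yin is refereed (its ingredients are refereed; the `𝓕_nr`
translation for anomalous `θ` is written only there). Not a change to the skeleton of record (v12).

References: [KellerYin2024] §1.2 Def. 1.2.1, Thm. 1.2.2, Rem. 1.2.3, Lemma 1.2.4, Prop. 1.2.5; Thm. 1.4.1; Lemma 5.1.1
(arXiv:2402.12781v2); [CastellaGrossiLeeSkinner2022] §1.2 Def. 10, Thm. 11, Lemma 13, Prop. 14, §1.4 Props. 17–18;
[Rubin1991] Thm. 4.1; [Hida2010MuInvariant] Thm. I; [GreenbergVatsal2000] §2 Prop. (2.8); [Brink2007] Cor. 1;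
[Castella2018] Def. 2.2; cell p626493, p628626, p624583, p621903, p613183 (chl-k1).
-/

set_option autoImplicit false
set_option linter.dupNamespace false -- the summit namespace `…BirchSwinnertonDyer.BirchSwinnertonDyer.Theorems` (Sub = Summit, D-0017) trips it

noncomputable section

open scoped Classical

open WeierstrassCurve NumberField IsDedekindDomain Field
  Literature.NumberTheory.EllipticCurves Literature.NumberTheory.EllipticCurves.IwasawaAlgebra
  Literature.NumberTheory.EllipticCurves.GreenbergSelmer
  Literature.NumberTheory.EllipticCurves.GreenbergVatsal2000
  Literature.NumberTheory.GaloisRepresentations IsDedekindDomain.HeightOneSpectrum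
  Literature.NumberTheory.EllipticCurves.Rank1Residual
  Summit.BirchSwinnertonDyer.Rank1Residual.X11b Summit.BirchSwinnertonDyer.Rank1Residual.X11b.AcSelmer
  Summit.BirchSwinnertonDyer.Rank1Residual.X2.ResidualDevissageModules
  Summit.BirchSwinnertonDyer.BirchSwinnertonDyer.Theorems
  Summit.BirchSwinnertonDyer.BirchSwinnertonDyer.Theorems.CumulativeHeegnerInclusionAtThreeResidualDevissage
  Summit.BirchSwinnertonDyer.BirchSwinnertonDyer.Theorems.CumulativeHeegnerInclusionAtThreeLineBaseChange
  Summit.BirchSwinnertonDyer.BirchSwinnertonDyer.Theorems.CumulativeHeegnerInclusionAtThreeBadPlaces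
  Summit.BirchSwinnertonDyer.BirchSwinnertonDyer.Theorems.AdditiveKoly.SplitCompletion
open Literature.NumberTheory.EllipticCurves.KellerYin2024
  (lemma511_imprimitive_isTorsion_muInvariant_eq_zero_mult_OPEN unrSelmer grSelmer grSelmer_le_unrSelmer)

namespace Summit.BirchSwinnertonDyer.BirchSwinnertonDyer.Theorems.KellerYinLemma511OfCharacterResidualFiniteness

/-! ### §1 Strict ⊆ unramified at `v̄` -/

/-- **Castella's residual group (STRICT at `𝔭`) is finite as soon as Keller–Yin's UNRAMIFIED one is**:
`R_𝔭^S(K_∞, M) = datumStrictSelmer (ker κ) M p (bdpData M p 𝔭) S ⊆ unrSelmer κ M 𝔭 S`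
(`KellerYin2024.grSelmer_le_unrSelmer`; the Summits-side `X11b.AcSelmer.bdpData` and Castella's
`Castella2018.AcSelmer.bdpData` agree definitionally). [cite: KellerYin2024, §1.2 display (Gr,θ) (arXiv:2402.12781v2)] -/
theorem strictResidual_finite_of_unrResidual_finite {K : Type} [Field K] [NumberField K] {p : ℕ} [Fact p.Prime]
    (κ : ZpExtension K p) (𝔭 : HeightOneSpectrum (𝓞 K)) (S : Set (HeightOneSpectrum (𝓞 K)))
    (M : Type) [AddCommGroup M] [DistribMulAction (absoluteGaloisGroup K) M] [TopologicalSpace M]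
    [DiscreteTopology M] (h : (KellerYin2024.unrSelmer κ M 𝔭 S : Set (subgroupH1 κ.kerSubgroup M)).Finite) :
    (datumStrictSelmer κ.kerSubgroup M p (AcSelmer.bdpData M p 𝔭) S : Set (subgroupH1 κ.kerSubgroup M)).Finite := by
  refine h.subset fun c hc ↦ ?_
  have hc' : c ∈ KellerYin2024.grSelmer κ M 𝔭 S := hc
  exact KellerYin2024.grSelmer_le_unrSelmer κ M 𝔭 S hc'

/-! ### §2 The fact ⟹ residual finiteness at EVERY multiplicative Eisenstein datum -/

/-- **Keller–Yin Prop. 1.2.5's finiteness clause for characters (hypothesis `hfact`, spelled out) ⟹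
`Sel_v̄^{Sf}(K_∞, E_K[p^∞])[p]` finite**, at every
datum of Lemma 5.1.1: `W/ℚ` globally minimal, `2 < p`, `p ‖ N` (split OR non-split), `E[p]` reducible; `K` imaginary
quadratic with the Heegner hypothesis for `N_E` and `(p)` split; `v̄ ∋ p`; `κ` anticyclotomic; `Sf` = the places of `K`
over `N_E` not over `p`. Proof: a rational line `Φ`; its base change `S ≤ E_K[p]` (order `p`, quotient of order
`p`); `Sf` finite, prime to `p`, over split rational primes (Heegner); `E_K[p]`, `S`, `E_K[p]/S` unramified off
`Sf ∪ {w ∣ p}` (good reduction there); the fact for `M = S.Sub` and `M = S.Quot` + §1; Brink's `D_{v̄} ⊄ ker κ`; the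
dévissage WITHOUT the non-anomalous clause (p628626 §3). NO local hypothesis on `Φ` is used — hence both signs.
CONDITIONAL on the preprint claim `hfact`; nothing else assumed.
[claim: KellerYin2024, status: under-review]
[cite: KellerYin2024, Prop. 1.2.5, Thm. 1.4.1, Lemma 5.1.1 (arXiv:2402.12781v2)]
[cite: CastellaGrossiLeeSkinner2022, §1.4 Props. 17–18 (arXiv:2008.02571)] [cite: Brink2007, Cor. 1] -/
theorem residualFinite_of_unrCharacterFinite
    (hfact : ∀ (K : Type) [Field K] [NumberField K] (p : ℕ) [Fact p.Prime],
      IsImaginaryQuadratic K → p ≠ 2 → ((Ideal.span {(p : ℤ)}).primesOver (𝓞 K)).ncard = 2 →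
      ∀ (κ : ZpExtension K p), κ.IsAnticyclotomic →
      ∀ (𝔭 : HeightOneSpectrum (𝓞 K)), ((p : ℕ) : 𝓞 K) ∈ 𝔭.asIdeal →
      ∀ (M : Type) [AddCommGroup M] [DistribMulAction (absoluteGaloisGroup K) M]
        [TopologicalSpace M] [DiscreteTopology M],
        Nat.card M = p → (∀ m : M, Continuous fun g : absoluteGaloisGroup K ↦ g • m) →
      ∀ (S : Set (HeightOneSpectrum (𝓞 K))), S.Finite →
        (∀ v ∈ S, ((p : ℕ) : 𝓞 K) ∉ v.asIdeal ∧
          ((v.asIdeal.under ℤ).primesOver (𝓞 K)).ncard = 2) →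
        (∀ v : HeightOneSpectrum (𝓞 K), v ∉ S → ((p : ℕ) : 𝓞 K) ∉ v.asIdeal →
          ∀ x ∈ inertia v, ∀ m : M, x • m = m) →
        (KellerYin2024.unrSelmer κ M 𝔭 S : Set (subgroupH1 κ.kerSubgroup M)).Finite)
    {p : ℕ} [hp : Fact p.Prime] (W : WeierstrassCurve ℚ) [W.IsElliptic] [W.IsGloballyMinimal]
    (K : Type) [Field K] [NumberField K] (vbar : HeightOneSpectrum (𝓞 K))
    (κ : ZpExtension K p) (Sf : Finset (HeightOneSpectrum (𝓞 K)))
    (hp2 : 2 < p) (hred : Red W p) (hK : IsImaginaryQuadratic K)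
    (hH : SatisfiesHeegnerHypothesis (W.conductorNorm ℤ) K)
    (hsplit : ((Ideal.span {(p : ℤ)}).primesOver (𝓞 K)).ncard = 2)
    (hvbar : ((p : ℕ) : 𝓞 K) ∈ vbar.asIdeal) (hκ : κ.IsAnticyclotomic)
    (hSf : ∀ w : HeightOneSpectrum (𝓞 K), w ∈ Sf ↔
      (((W.conductorNorm ℤ : ℤ) : 𝓞 K) ∈ w.asIdeal ∧ ((p : ℕ) : 𝓞 K) ∉ w.asIdeal)) :
    Set.Finite {s : selmerAc (W.baseChange K) p κ vbar (↑Sf : Set (HeightOneSpectrum (𝓞 K))) |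
      p • s = 0} := by
  have hpp : p.Prime := hp.out
  have hp2' : p ≠ 2 := by omega
  haveI hEK : (W.baseChange K).IsElliptic := inferInstanceAs (W.map (algebraMap ℚ K)).IsElliptic
  /- a rational line and its base change to `K` -/
  obtain ⟨Φ, hΦ⟩ := exists_isRationalLine_of_not_irr W p hred
  obtain ⟨t, ht⟩ := exists_geomTorsion_baseChange_equiv W K ((p : ℕ) : ℤ)
  have ht' : ∀ (σ : absoluteGaloisGroup K) (P : W.geomTorsion ((p : ℕ) : ℤ)),
      t (absGaloisRestrict ℚ K σ • P) = σ • t P := fun σ P ↦ by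
    rw [← resGal_eq_absGaloisRestrict]; exact ht σ P
  obtain ⟨S, -, hcardS⟩ := exists_stableSubgroup_corr Φ t ht' hΦ.2
  have hSub : Nat.card S.Sub = p := by rw [hcardS, hΦ.1]
  have hEp : Nat.card ((W.baseChange K).geomTorsion ((p : ℕ) : ℤ)) = p ^ 2 :=
    (W.baseChange K).natCard_geomTorsion_prime_eq_sq hpp
  have hQuot : Nat.card S.Quot = p := by
    have h := S.natCard_eq_mul
    rw [hEp, hSub, sq] at h
    exact (Nat.eq_of_mul_eq_mul_right hpp.pos h).symm
  /- the imprimitivity set `Sf`: finite, prime to `p`, over split rational primes; good reduction off it -/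
  set S₀ : Set (HeightOneSpectrum (𝓞 K)) := (↑Sf : Set (HeightOneSpectrum (𝓞 K))) with hS₀
  have hS₀fin : S₀.Finite := Sf.finite_toSet
  have hgood : ∀ w : HeightOneSpectrum (𝓞 K), w ∉ S₀ → ((p : ℕ) : 𝓞 K) ∉ w.asIdeal →
      (W.baseChange K).HasGoodReductionAt w := fun w hw hpw ↦ by
    by_contra hbad
    obtain ⟨ℓ, -, hℓw, hℓN⟩ := exists_prime_mem_dvd_conductorNorm_of_not_hasGoodReductionAt W K w hbad
    apply hw
    rw [hS₀, Finset.mem_coe, hSf]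
    refine ⟨?_, hpw⟩
    obtain ⟨m, hm⟩ := hℓN
    rw [hm, Nat.cast_mul, Int.cast_mul, Int.cast_natCast]
    exact w.asIdeal.mul_mem_right _ hℓw
  have hS₀mem : ∀ w ∈ S₀, ((p : ℕ) : 𝓞 K) ∉ w.asIdeal ∧
      ((w.asIdeal.under ℤ).primesOver (𝓞 K)).ncard = 2 := fun w hw ↦ by
    rw [hS₀, Finset.mem_coe, hSf] at hw
    refine ⟨hw.2, ?_⟩
    obtain ⟨ℓ, hℓ, hℓw⟩ := exists_prime_natCast_mem_asIdeal w
    haveI : Fact ℓ.Prime := ⟨hℓ⟩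
    have hunder : w.asIdeal.under ℤ = Ideal.span {(ℓ : ℤ)} :=
      (liesOver_span_int K ℓ w (by exact_mod_cast hℓw)).over.symm
    have hℓN : ℓ ∣ W.conductorNorm ℤ := by
      have hmem : ((W.conductorNorm ℤ : ℕ) : ℤ) ∈ w.asIdeal.under ℤ := by
        rw [Ideal.under_def, Ideal.mem_comap, map_natCast]
        have := hw.1
        rwa [Int.cast_natCast] at this
      rw [hunder, Ideal.mem_span_singleton] at hmem
      exact_mod_cast hmem
    rw [hunder]
    exact hH ℓ hℓ hℓN
  /- unramified outside `S₀ ∪ {w ∣ p}` -/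
  have hM : ∀ m : (W.baseChange K).geomTorsion ((p : ℕ) : ℤ),
      Continuous fun g : absoluteGaloisGroup K ↦ g • m :=
    continuous_smul_geomTorsion (W.baseChange K) ((p : ℕ) : ℤ)
  have hunrE : ∀ w : HeightOneSpectrum (𝓞 K), w ∉ S₀ → ((p : ℕ) : 𝓞 K) ∉ w.asIdeal →
      ∀ x ∈ inertia w, ∀ m : (W.baseChange K).geomTorsion ((p : ℕ) : ℤ), x • m = m :=
    fun w hw hpw x hx m ↦ smul_geomTorsion_eq_of_mem_inertia_chosen (W.baseChange K) (hgood w hw hpw) hpw hx m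
  have hunrSub : ∀ w : HeightOneSpectrum (𝓞 K), w ∉ S₀ → ((p : ℕ) : 𝓞 K) ∉ w.asIdeal →
      ∀ x ∈ inertia w, ∀ m : S.Sub, x • m = m := fun w hw hpw x hx m ↦
    S.incl_injective (by rw [StableSubgroup.incl_smul]; exact hunrE w hw hpw x hx _)
  have hunrQuot : ∀ w : HeightOneSpectrum (𝓞 K), w ∉ S₀ → ((p : ℕ) : 𝓞 K) ∉ w.asIdeal →
      ∀ x ∈ inertia w, ∀ m : S.Quot, x • m = m := fun w hw hpw x hx m ↦ by
    obtain ⟨n, rfl⟩ := S.proj_surjective m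
    rw [StableSubgroup.smul_proj, hunrE w hw hpw x hx]
  /- Brink: `v̄` is finitely decomposed in `K_∞` -/
  have h𝔭dec : ¬ (decomp vbar ≤ κ.kerSubgroup) :=
    ZpExtension.decomp_not_le_kerSubgroup_above_of_isAnticyclotomic_holds K p hK hp2' κ hκ vbar hvbar
  /- the preprint fact for the two characters, then strict ⊆ unramified -/
  have hΦfin : (datumStrictSelmer κ.kerSubgroup S.Sub p (AcSelmer.bdpData S.Sub p vbar) S₀ :
      Set (Literature.NumberTheory.EllipticCurves.subgroupH1 κ.kerSubgroup S.Sub)).Finite :=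
    strictResidual_finite_of_unrResidual_finite κ vbar S₀ S.Sub
      (hfact K p hK hp2' hsplit κ hκ vbar hvbar S.Sub hSub (S.continuous_smul_sub hM) S₀ hS₀fin hS₀mem
        hunrSub)
  have hΨfin : (datumStrictSelmer κ.kerSubgroup S.Quot p (AcSelmer.bdpData S.Quot p vbar) S₀ :
      Set (Literature.NumberTheory.EllipticCurves.subgroupH1 κ.kerSubgroup S.Quot)).Finite :=
    strictResidual_finite_of_unrResidual_finite κ vbar S₀ S.Quot
      (hfact K p hK hp2' hsplit κ hκ vbar hvbar S.Quot hQuot (S.continuous_smul_quot hM) S₀ hS₀fin hS₀mem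
        hunrQuot)
  exact ResidualDevissageFiniteKernel.finite_selmerAc_pTorsion_of_line_devissage_of_finite (W.baseChange K) κ
    hvbar h𝔭dec hgood S hΦfin hΨfin

/-! ### §3 `stub_lemma511` (both signs) from the character-level fact -/

/-- **Keller–Yin Prop. 1.2.5's finiteness clause (hypothesis `hfact`) ⟹ `X^{Sf}` is `Λ`-torsion with `μ = 0` at
every multiplicative Eisenstein datum** (§2 + Greenberg's criterion (A), tree `UniversalToricDescentAcDualMuZero.*`). CONDITIONAL on the
preprint claim. [claim: KellerYin2024, status: under-review]
[cite: KellerYin2024, Prop. 1.2.5 and Lemma 5.1.1 (arXiv:2402.12781v2)] [cite: GreenbergLNM1716, §1 p. 60]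
[cite: GreenbergVatsal2000, §2 Prop. (2.8)] -/
theorem isTorsion_muInvariant_eq_zero_of_unrCharacterFinite
    (hfact : ∀ (K : Type) [Field K] [NumberField K] (p : ℕ) [Fact p.Prime],
      IsImaginaryQuadratic K → p ≠ 2 → ((Ideal.span {(p : ℤ)}).primesOver (𝓞 K)).ncard = 2 →
      ∀ (κ : ZpExtension K p), κ.IsAnticyclotomic →
      ∀ (𝔭 : HeightOneSpectrum (𝓞 K)), ((p : ℕ) : 𝓞 K) ∈ 𝔭.asIdeal →
      ∀ (M : Type) [AddCommGroup M] [DistribMulAction (absoluteGaloisGroup K) M]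
        [TopologicalSpace M] [DiscreteTopology M],
        Nat.card M = p → (∀ m : M, Continuous fun g : absoluteGaloisGroup K ↦ g • m) →
      ∀ (S : Set (HeightOneSpectrum (𝓞 K))), S.Finite →
        (∀ v ∈ S, ((p : ℕ) : 𝓞 K) ∉ v.asIdeal ∧
          ((v.asIdeal.under ℤ).primesOver (𝓞 K)).ncard = 2) →
        (∀ v : HeightOneSpectrum (𝓞 K), v ∉ S → ((p : ℕ) : 𝓞 K) ∉ v.asIdeal →
          ∀ x ∈ inertia v, ∀ m : M, x • m = m) →
        (KellerYin2024.unrSelmer κ M 𝔭 S : Set (subgroupH1 κ.kerSubgroup M)).Finite)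
    {p : ℕ} [Fact p.Prime] (W : WeierstrassCurve ℚ) [W.IsElliptic] [W.IsGloballyMinimal]
    (K : Type) [Field K] [NumberField K] (vbar : HeightOneSpectrum (𝓞 K))
    (κ : ZpExtension K p) (γ : absoluteGaloisGroup K) [Fact (κ.IsTopGenerator γ)]
    (Sf : Finset (HeightOneSpectrum (𝓞 K)))
    (hp2 : 2 < p) (hred : Red W p) (hK : IsImaginaryQuadratic K)
    (hH : SatisfiesHeegnerHypothesis (W.conductorNorm ℤ) K)
    (hsplit : ((Ideal.span {(p : ℤ)}).primesOver (𝓞 K)).ncard = 2)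
    (hvbar : ((p : ℕ) : 𝓞 K) ∈ vbar.asIdeal) (hκ : κ.IsAnticyclotomic)
    (hSf : ∀ w : HeightOneSpectrum (𝓞 K), w ∈ Sf ↔
      (((W.conductorNorm ℤ : ℤ) : 𝓞 K) ∈ w.asIdeal ∧ ((p : ℕ) : 𝓞 K) ∉ w.asIdeal)) :
    Module.IsTorsion (IwasawaAlgebra p)
        (XAc (W.baseChange K) p κ vbar (↑Sf : Set (HeightOneSpectrum (𝓞 K))) γ) ∧
      muInvariant p (XAc (W.baseChange K) p κ vbar (↑Sf : Set (HeightOneSpectrum (𝓞 K))) γ) = 0 := by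
  haveI : (W.baseChange K).IsElliptic := inferInstanceAs (W.map (algebraMap ℚ K)).IsElliptic
  have hS : (↑Sf : Set (HeightOneSpectrum (𝓞 K))).Finite := Finset.finite_toSet Sf
  have hfin := residualFinite_of_unrCharacterFinite hfact W K vbar κ Sf hp2 hred hK hH hsplit hvbar hκ hSf
  exact ⟨UniversalToricDescentAcDualMuZero.isTorsion_of_finite_pTorsion (W.baseChange K) p κ vbar _ γ hS hfin,
    UniversalToricDescentAcDualMuZero.muInvariant_eq_zero_of_finite_pTorsion (W.baseChange K) p κ vbar _ γ
      hS hfin⟩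

/-- **v12's `stub_lemma511` BY NAME from the character-level preprint clause (spelled out as `hfact`; =
`KellerYin2024.prop125_residualCharacterUnrSelmer_finite_OPEN` binder for binder) — both signs**
(through p624583's `lemma511_OPEN_of_residualFinite` and §2; the binders `Mult`, `Odd d_K`, `d_K ≠ −3` of
the target are not needed). CONDITIONAL: an unrefereed claim about characters of `K` implies the unrefereed
`E`-level claim. [claim: KellerYin2024, status: under-review]
[cite: KellerYin2024, Prop. 1.2.5 ⟹ Lemma 5.1.1 ("This is essentially proved in Theorem 1.4.1 since the proof only relies on the extension 0 → 𝔽(φ) → ρ̄_f → 𝔽(ψ) → 0"; arXiv:2402.12781v2 §5.1 TeX L1744–1749)] -/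
theorem lemma511_OPEN_of_unrCharacterFinite
    (hfact : ∀ (K : Type) [Field K] [NumberField K] (p : ℕ) [Fact p.Prime],
      IsImaginaryQuadratic K → p ≠ 2 → ((Ideal.span {(p : ℤ)}).primesOver (𝓞 K)).ncard = 2 →
      ∀ (κ : ZpExtension K p), κ.IsAnticyclotomic →
      ∀ (𝔭 : HeightOneSpectrum (𝓞 K)), ((p : ℕ) : 𝓞 K) ∈ 𝔭.asIdeal →
      ∀ (M : Type) [AddCommGroup M] [DistribMulAction (absoluteGaloisGroup K) M]
        [TopologicalSpace M] [DiscreteTopology M],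
        Nat.card M = p → (∀ m : M, Continuous fun g : absoluteGaloisGroup K ↦ g • m) →
      ∀ (S : Set (HeightOneSpectrum (𝓞 K))), S.Finite →
        (∀ v ∈ S, ((p : ℕ) : 𝓞 K) ∉ v.asIdeal ∧
          ((v.asIdeal.under ℤ).primesOver (𝓞 K)).ncard = 2) →
        (∀ v : HeightOneSpectrum (𝓞 K), v ∉ S → ((p : ℕ) : 𝓞 K) ∉ v.asIdeal →
          ∀ x ∈ inertia v, ∀ m : M, x • m = m) →
        (KellerYin2024.unrSelmer κ M 𝔭 S : Set (subgroupH1 κ.kerSubgroup M)).Finite) :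
    lemma511_imprimitive_isTorsion_muInvariant_eq_zero_mult_OPEN :=
  KellerYinLemma511ResidualFinite.lemma511_OPEN_of_residualFinite
    fun W _ _ K _ _ vbar κ _ _ Sf hp _ hred hK hH _ _ hsplit hvbar hκ hSf ↦
      residualFinite_of_unrCharacterFinite hfact W K vbar κ Sf hp hred hK hH hsplit hvbar hκ hSf

end Summit.BirchSwinnertonDyer.BirchSwinnertonDyer.Theorems.KellerYinLemma511OfCharacterResidualFiniteness

end
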